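import Summits.RiemannHypothesis.RiemannHypothesis.Theorems.GroundBartaEvenWinsBeyondArchDeflationCertBridgeWXA
import Summits.RiemannHypothesis.RiemannHypothesis.Theorems.GroundBartaEvenWinsBeyondArchDeflationSliverEdgeN
import HarnessLib

/-!
# RiemannHypothesis / GroundBarta — rung 4 (`EvenWinsBeyondArch`, stmt-RiemannHypothesis-18807 / 18085):
# the deflated Temple L-side BEYOND `(log 5)/2` — three-zone bridge (slivers of `4` and `5`) with approximate cut vectors

Helper file (`--supports stmt-RiemannHypothesis-18085`), RH-free, no definitions, no named facts.  Prover A (gen 11 of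
unit `sr-gb-rung-a`); the `{2,3,4,5}`-window successor of prover B's `…DeflationCertBridgeWXA` (which is tied to
`c ≤ (log 5)/2` and ONE edge zone).

Setting: test window `c` with `log 2 < c' ≤ c ≤ (log 7)/2`, `c ≤ b`, `c ≤ a₀`, and `c'`, `c` in the same prime band
(hypotheses `hPI`, `hM`, `hE₂`: equal prime index, killing constant and bilinear Dirichlet energy — `rfl` when `c' = c`):

* the rank-one augmented two-prime certificate `hcert23` on `[-a₀, a₀]` (penalty data `R`, level `β₂₃`);
* trial vectors `v_i = 𝟙_{[-c',c']}·g_i`, `g_i ∈ C²` of parity `σ` (any profiles), extended images `Fx_i` at `b`;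
* the leak `ν` (penalty/profile mismatch + shell, `dt_cert_leak_approx`) lowers the level to `β' = β₂₃ − 2ν`;
* the newly visible prime powers `4` and `5` are charged ONLY on the edges
  (`dt_weilTwoPrimeQuadratic_sub_edges45_le_weilQuadratic_re`): pointwise level
  `n(y) = β' − λ − κ₄ 𝟙_{|y| ≥ y₄} − κ₅ 𝟙_{|y| ≥ y₅}` with `κ₄ ≥ (log 2)/2`, `κ₅ ≥ log 5/√5`, `y₄ ≤ log 4 − c`,
  `y₅ ≤ log 5 − c`, `y₄ ≤ y₅`, i.e. THREE weight zones `wI = 1/(β' − λ)` (`|y| < y₄`), `wM = 1/(β' − κ₄ − λ)`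
  (`y₄ ≤ |y| < y₅`), `wE = 1/(β' − κ₄ − κ₅ − λ)` (`|y| ≥ y₅`), and `λ < β' − κ₄ − κ₅`;
* the PSD datum `A(c') − λG − R_w(Fx) ⪰ 0` with the window-`c'` matrix entries.

Conclusion (`dt_sector_bound_of_deflCert_wxa45`, `dt_weil{Odd,Even}GroundEnergy_ge_of_deflCert_wxa45`):
`λ ≤ ε_od(c)` / `λ ≤ ε_ev(c)`.  Since `β' − κ₄ − κ₅ − λ > 0` is required, the certificate level must exceed
`ℓ(3,5) = (log 2)/2 + log 5/√5 ≈ 1.0663` plus the leak and `λ`: this is why the windows beyond `(log 5)/2` need the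
sharp tail level / a longer minorant chain (`…TwoPrimeTailLevel`).
-/

set_option linter.dupNamespace false

noncomputable section

open MeasureTheory Set Filter
open scoped Topology ENNReal NNReal ComplexConjugate BigOperators

namespace Summit.RiemannHypothesis.RiemannHypothesis.Theorems.EvenWinsBeyondArch

open Literature.NumberTheory.LFunctions Literature.NumberTheory.LFunctions.ConnesVanSuijlekom
open Summit.RiemannHypothesis.RiemannHypothesis.Theorems.OddSector (weilDirichletEnergy₂ weilPoleForm₂)
open Summit.RiemannHypothesis.RiemannHypothesis.Theorems.GroundStateSimpleEven (incs_memLp)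

/-- A three-zone step function: `E₅.piecewise a (E₄.piecewise b d) = d + (b − d)𝟙_{E₄} + (a − b)𝟙_{E₅}` pointwise
when `E₅ ⊆ E₄`. [folklore] -/
theorem dt_piecewise3_eq {E₄ E₅ : Set ℝ} [DecidablePred (· ∈ E₄)] [DecidablePred (· ∈ E₅)] (h54 : E₅ ⊆ E₄)
    (a b d : ℝ) (y : ℝ) :
    E₅.piecewise (fun _ ↦ a) (E₄.piecewise (fun _ ↦ b) (fun _ ↦ d)) y =
      d + (b - d) * E₄.indicator (fun _ ↦ (1 : ℝ)) y + (a - b) * E₅.indicator (fun _ ↦ (1 : ℝ)) y := by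
  by_cases h5 : y ∈ E₅
  · rw [Set.piecewise_eq_of_mem _ _ _ h5, indicator_of_mem (h54 h5), indicator_of_mem h5]; ring
  · rw [Set.piecewise_eq_of_notMem _ _ _ h5, indicator_of_notMem h5]
    by_cases h4 : y ∈ E₄
    · rw [Set.piecewise_eq_of_mem _ _ _ h4, indicator_of_mem h4]; ring
    · rw [Set.piecewise_eq_of_notMem _ _ _ h4, indicator_of_notMem h4]; ring

/-- Integral of a three-zone step function against an integrable `f`:
`∫ E₅.piecewise a (E₄.piecewise b d) · f = d∫f + (b − d)∫𝟙_{E₄} f + (a − b)∫𝟙_{E₅} f` (`E₅ ⊆ E₄`). [folklore] -/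
theorem dt_integral_piecewise3_mul {E₄ E₅ : Set ℝ} [DecidablePred (· ∈ E₄)] [DecidablePred (· ∈ E₅)]
    (hE₄ : MeasurableSet E₄) (hE₅ : MeasurableSet E₅) (h54 : E₅ ⊆ E₄) (a b d : ℝ) {f : ℝ → ℝ}
    (hf : Integrable f) :
    ∫ y, E₅.piecewise (fun _ ↦ a) (E₄.piecewise (fun _ ↦ b) (fun _ ↦ d)) y * f y =
      d * (∫ y, f y) + (b - d) * (∫ y, E₄.indicator f y) + (a - b) * ∫ y, E₅.indicator f y := by
  have hpt : ∀ y, E₅.piecewise (fun _ ↦ a) (E₄.piecewise (fun _ ↦ b) (fun _ ↦ d)) y * f y =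
      d * f y + (b - d) * E₄.indicator f y + (a - b) * E₅.indicator f y := by
    intro y
    rw [dt_piecewise3_eq h54 a b d y]
    have h4 : E₄.indicator f y = E₄.indicator (fun _ ↦ (1 : ℝ)) y * f y := by
      by_cases hy : y ∈ E₄
      · rw [indicator_of_mem hy, indicator_of_mem hy, one_mul]
      · rw [indicator_of_notMem hy, indicator_of_notMem hy, zero_mul]
    have h5 : E₅.indicator f y = E₅.indicator (fun _ ↦ (1 : ℝ)) y * f y := by
      by_cases hy : y ∈ E₅
      · rw [indicator_of_mem hy, indicator_of_mem hy, one_mul]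
      · rw [indicator_of_notMem hy, indicator_of_notMem hy, zero_mul]
    rw [h4, h5]; ring
  simp_rw [hpt]
  have i4 : Integrable (E₄.indicator f) := hf.indicator hE₄
  have i5 : Integrable (E₅.indicator f) := hf.indicator hE₅
  have e1 : (∫ y, d * f y + (b - d) * E₄.indicator f y + (a - b) * E₅.indicator f y) =
      (∫ y, d * f y + (b - d) * E₄.indicator f y) + ∫ y, (a - b) * E₅.indicator f y :=
    integral_add ((hf.const_mul d).add (i4.const_mul _)) (i5.const_mul _)
  have e2 : (∫ y, d * f y + (b - d) * E₄.indicator f y) =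
      (∫ y, d * f y) + ∫ y, (b - d) * E₄.indicator f y :=
    integral_add (hf.const_mul d) (i4.const_mul _)
  rw [e1, e2, integral_const_mul, integral_const_mul, integral_const_mul]

/-- **The three-zone bridge with approximate trial vectors, parity `σ`** (windows up to `(log 7)/2`).  Certificate on
`[-a₀, a₀]`, trial vectors `𝟙_{[-c',c']}·g_i` (`g_i ∈ C²`, parity `σ`), extended images at `b`, leak `ν`, edge-only
slivers of `4` and `5`, weighted PSD datum with the window-`c'` matrix ⇒ `λ∫|φ|² ≤ Re Q(φ)` for every smooth
parity-`σ` test `φ` of the window `[-c, c]`. [folklore] -/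
theorem dt_sector_bound_of_deflCert_wxa45 {c c' b a₀ : ℝ} (hc'2 : Real.log 2 < c') (hcc : c' ≤ c)
    (hc7 : c ≤ Real.log 7 / 2) (hcb : c ≤ b) (hca : c ≤ a₀)
    (hPI : weilPrimeIndex c = weilPrimeIndex c') (hM : weilMarkovConstant c = weilMarkovConstant c')
    (hE₂ : ∀ f h, weilDirichletEnergy₂ c f h = weilDirichletEnergy₂ c' f h) (σ : ℝ)
    (R : List (ℚ × ℕ × List ℚ)) (n : ℕ) {β₂₃ : ℝ}
    (g : Fin R.length → ℝ → ℝ) (hg : ∀ i, ContDiff ℝ 2 (g i)) (hgp : ∀ i x, g i (-x) = σ * g i x)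
    (hRμ : ∀ i : Fin R.length, 0 ≤ (R.get i).1)
    (hcert23 : ∀ g : ℝ → ℂ, IsWeilTest g → tsupport g ⊆ Icc (-a₀) a₀ → (∀ x, g (-x) = (σ : ℂ) * g x) →
      β₂₃ * weilNorm2Sq g ≤ weilTwoPrimeQuadratic g +
        (R.map fun r ↦ (r.1 : ℝ) * ‖∑ k ∈ Finset.range n, ((maskV r k : ℚ) : ℂ) * weilMoment a₀ g k‖ ^ 2).sum)
    (v Fx : Fin R.length → ℝ → ℂ)
    (hv : ∀ i x, v i x = (((Icc (-c') c').indicator (g i) x : ℝ) : ℂ))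
    (hFx : ∀ i y, Fx i y = (Icc (-b) b).indicator (fun y ↦
        2 * (∫ x, v i x * (Real.cosh (x / 2) : ℂ)) * (Real.cosh (y / 2) : ℂ) -
          2 * (∫ x, v i x * (Real.sinh (x / 2) : ℂ)) * (Real.sinh (y / 2) : ℂ) +
        (∑ m ∈ weilPrimeIndex c', (((ArithmeticFunction.vonMangoldt m : ℝ) / Real.sqrt m : ℝ) : ℂ) *
          (2 * v i y - v i (y - Real.log m) - v i (y + Real.log m))) +
        ∫ t in Ioi 0, (weilArchDensity t : ℂ) * (2 * v i y - v i (y - t) - v i (y + t))) y -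
      (weilMarkovConstant c' : ℂ) * v i y)
    (W : Fin R.length → Fin R.length → ℝ) {κ₄ κ₅ : ℝ} (hκ₄ : Real.log 2 / 2 ≤ κ₄)
    (hκ₅ : Real.log 5 / Real.sqrt 5 ≤ κ₅)
    {ν : ℝ} (hν : ∑ i : Fin R.length, ((R.get i).1 : ℝ) *
      ((∫ x in Icc (-c') c', (maskPoly (R.get i) n a₀ x - g i x) ^ 2) +
        ∫ x in Icc (-a₀) a₀ \ Icc (-c') c', (maskPoly (R.get i) n a₀ x) ^ 2) ≤ ν)
    {lam : ℝ} (hlam : lam < β₂₃ - 2 * ν - κ₄ - κ₅) {y₄ y₅ : ℝ} (hy₄ : y₄ ≤ Real.log 4 - c)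
    (hy₅ : y₅ ≤ Real.log 5 - c) (hy45 : y₄ ≤ y₅)
    (hPSD : ∀ α : Fin R.length → ℝ, 0 ≤ ∑ i, ∑ j, α i * α j *
      ((weilPoleForm₂ (v i) (v j) + weilDirichletEnergy₂ c' (v i) (v j) -
          weilMarkovConstant c' * ∫ x, (v i x * conj (v j x)).re) - lam * (∫ x, (v i x * conj (v j x)).re) -
        ∫ y, {u : ℝ | y₅ ≤ |u|}.piecewise (fun _ ↦ 1 / (β₂₃ - 2 * ν - κ₄ - κ₅ - lam))
            ({u : ℝ | y₄ ≤ |u|}.piecewise (fun _ ↦ 1 / (β₂₃ - 2 * ν - κ₄ - lam))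
              (fun _ ↦ 1 / (β₂₃ - 2 * ν - lam))) y *
          ((Fx i - ∑ l, W i l • v l) y * conj ((Fx j - ∑ l, W j l • v l) y)).re))
    {φ : ℝ → ℂ} (hφ : IsWeilTest φ) (hφs : tsupport φ ⊆ Icc (-c) c) (hφp : ∀ x, φ (-x) = (σ : ℂ) * φ x) :
    lam * ∫ x, ‖φ x‖ ^ 2 ≤ (weilQuadratic φ).re := by
  have hlog2 : 0 < Real.log 2 := Real.log_pos (by norm_num)
  have hc' : 0 < c' := hlog2.trans hc'2
  have hcb' : c' ≤ b := hcc.trans hcb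
  set E₄ : Set ℝ := {u : ℝ | y₄ ≤ |u|} with hE₄def
  set E₅ : Set ℝ := {u : ℝ | y₅ ≤ |u|} with hE₅def
  have hE₄ : MeasurableSet E₄ := measurableSet_le measurable_const continuous_abs.measurable
  have hE₅ : MeasurableSet E₅ := measurableSet_le measurable_const continuous_abs.measurable
  have h54 : E₅ ⊆ E₄ := fun u (hu : y₅ ≤ |u|) ↦ show y₄ ≤ |u| from hy45.trans hu
  -- the window-`c` images
  set F : Fin R.length → ℝ → ℂ := fun i y ↦ (Icc (-c) c).indicator (fun y ↦
        2 * (∫ x, v i x * (Real.cosh (x / 2) : ℂ)) * (Real.cosh (y / 2) : ℂ) -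
          2 * (∫ x, v i x * (Real.sinh (x / 2) : ℂ)) * (Real.sinh (y / 2) : ℂ) +
        (∑ m ∈ weilPrimeIndex c, (((ArithmeticFunction.vonMangoldt m : ℝ) / Real.sqrt m : ℝ) : ℂ) *
          (2 * v i y - v i (y - Real.log m) - v i (y + Real.log m))) +
        ∫ t in Ioi 0, (weilArchDensity t : ℂ) * (2 * v i y - v i (y - t) - v i (y + t))) y -
      (weilMarkovConstant c : ℂ) * v i y with hFdef
  -- the vectors
  have hpc : ∀ i, ContDiff ℝ 2 (g i) := hg
  have hvM : ∀ i, MemLp (v i) 2 := fun i ↦ (dt_cut_mem_formDomain hc' hcc σ ((hpc i).of_le (by norm_num))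
    (hgp i) (hv i)).1
  have hvout : ∀ i y, y ∉ Icc (-c') c' → v i y = 0 := fun i y hy ↦ by rw [hv i y, indicator_of_notMem hy]; simp
  -- the three levels
  set nI : ℝ := β₂₃ - 2 * ν - lam with hnI
  set nM : ℝ := β₂₃ - 2 * ν - κ₄ - lam with hnM
  set nE : ℝ := β₂₃ - 2 * ν - κ₄ - κ₅ - lam with hnE
  have hκ₄0 : 0 ≤ κ₄ := le_trans (by positivity) hκ₄
  have hκ₅0 : 0 ≤ κ₅ := le_trans (by positivity) hκ₅
  have hnE0 : 0 < nE := by rw [hnE]; linarith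
  have hnM0 : 0 < nM := by rw [hnM]; linarith
  have hnI0 : 0 < nI := by rw [hnI]; linarith
  have hnEM : nE ≤ nM := by rw [hnE, hnM]; linarith
  have hnMI : nM ≤ nI := by rw [hnM, hnI]; linarith
  set C : ℝ := nI + 1 / nE with hC
  set nf : ℝ → ℝ := E₅.piecewise (fun _ ↦ nE) (E₄.piecewise (fun _ ↦ nM) (fun _ ↦ nI)) with hnfdef
  set w : ℝ → ℝ := E₅.piecewise (fun _ ↦ 1 / nE) (E₄.piecewise (fun _ ↦ 1 / nM) (fun _ ↦ 1 / nI)) with hwdef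
  -- the three cases of a point
  have hcase : ∀ y, (nf y = nE ∧ w y = 1 / nE) ∨ (nf y = nM ∧ w y = 1 / nM) ∨ (nf y = nI ∧ w y = 1 / nI) := by
    intro y
    by_cases h5 : y ∈ E₅
    · exact Or.inl ⟨Set.piecewise_eq_of_mem _ _ _ h5, Set.piecewise_eq_of_mem _ _ _ h5⟩
    · by_cases h4 : y ∈ E₄
      · refine Or.inr (Or.inl ⟨?_, ?_⟩)
        · rw [hnfdef, Set.piecewise_eq_of_notMem _ _ _ h5, Set.piecewise_eq_of_mem _ _ _ h4]
        · rw [hwdef, Set.piecewise_eq_of_notMem _ _ _ h5, Set.piecewise_eq_of_mem _ _ _ h4]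
      · refine Or.inr (Or.inr ⟨?_, ?_⟩)
        · rw [hnfdef, Set.piecewise_eq_of_notMem _ _ _ h5, Set.piecewise_eq_of_notMem _ _ _ h4]
        · rw [hwdef, Set.piecewise_eq_of_notMem _ _ _ h5, Set.piecewise_eq_of_notMem _ _ _ h4]
  have hmeas3 : ∀ a₁ a₂ a₃ : ℝ,
      Measurable (E₅.piecewise (fun _ ↦ a₁) (E₄.piecewise (fun _ ↦ a₂) (fun _ ↦ a₃))) := fun a₁ a₂ a₃ ↦
    Measurable.piecewise hE₅ measurable_const (Measurable.piecewise hE₄ measurable_const measurable_const)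
  have hnfm : Measurable nf := hmeas3 _ _ _
  have hwm : Measurable w := hmeas3 _ _ _
  have h1E : 1 / nI ≤ 1 / nE := one_div_le_one_div_of_le hnE0 (hnEM.trans hnMI)
  have h1M : 1 / nM ≤ 1 / nE := one_div_le_one_div_of_le hnE0 hnEM
  have hwC : ∀ y, |w y| ≤ C := by
    intro y
    rcases hcase y with ⟨_, h⟩ | ⟨_, h⟩ | ⟨_, h⟩ <;> rw [h, abs_of_pos (by positivity), hC] <;>
      linarith [hnI0.le]
  have hw0 : ∀ y, 0 ≤ w y := by
    intro y; rcases hcase y with ⟨_, h⟩ | ⟨_, h⟩ | ⟨_, h⟩ <;> rw [h] <;> positivity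
  have hnC : ∀ y, |nf y| ≤ C := by
    intro y
    have h1 : 0 ≤ 1 / nE := by positivity
    rcases hcase y with ⟨h, _⟩ | ⟨h, _⟩ | ⟨h, _⟩ <;> rw [h]
    · rw [abs_of_pos hnE0, hC]; linarith
    · rw [abs_of_pos hnM0, hC]; linarith
    · rw [abs_of_pos hnI0, hC]; linarith
  have hn0 : ∀ y, 0 ≤ nf y := by
    intro y; rcases hcase y with ⟨h, _⟩ | ⟨h, _⟩ | ⟨h, _⟩ <;> rw [h] <;> positivity
  have hwn : ∀ y, w y * nf y = 1 := by
    intro y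
    rcases hcase y with ⟨h, h'⟩ | ⟨h, h'⟩ | ⟨h, h'⟩ <;> rw [h, h'] <;> field_simp
  -- the PSD datum at the window `c`
  have hPSD' : ∀ α : Fin R.length → ℝ, 0 ≤ ∑ i, ∑ j, α i * α j *
      ((weilPoleForm₂ (v i) (v j) + weilDirichletEnergy₂ c (v i) (v j) -
          weilMarkovConstant c * ∫ x, (v i x * conj (v j x)).re) - lam * (∫ x, (v i x * conj (v j x)).re) -
        ∫ y, w y * ((F i - ∑ l, W i l • v l) y * conj ((F j - ∑ l, W j l • v l) y)).re) := by
    have hr : ∀ i, MemLp (F i - ∑ l, W i l • v l) 2 := by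
      intro i
      obtain ⟨m, hm, hH⟩ := dt_exists_majorant_of_contDiff_cut hc' hcc (hpc i) (hv i)
      exact (dt_windowImage_memLp_ae (hvM i) hm hH (fun y ↦ by rw [hFdef])).sub
        (memLp_finsetSum' _ fun l _ ↦ (hvM l).const_smul _)
    have hrx : ∀ i, MemLp (Fx i - ∑ l, W i l • v l) 2 := by
      intro i
      obtain ⟨m, hm, hH⟩ := dt_exists_majorant_of_contDiff_cut hc' hcb' (hpc i) (hv i)
      exact (dt_windowImageX_memLp (hvM i) hm hH (weilPrimeIndex c') (weilMarkovConstant c') (hFx i)).sub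
        (memLp_finsetSum' _ fun l _ ↦ (hvM l).const_smul _)
    have hdom : ∀ y, (∀ i, (F i - ∑ l, W i l • v l) y = (Fx i - ∑ l, W i l • v l) y) ∨
        (∀ i, (F i - ∑ l, W i l • v l) y = 0) := by
      intro y
      by_cases hy' : y ∈ Icc (-c) c
      · refine Or.inl fun i ↦ ?_
        have hyb : y ∈ Icc (-b) b := Icc_subset_Icc (by linarith) hcb hy'
        simp only [Pi.sub_apply, hFdef, hFx i y, indicator_of_mem hy', indicator_of_mem hyb, hPI, hM]
      · refine Or.inr fun i ↦ ?_
        have hvy : ∀ l, v l y = 0 := fun l ↦ hvout l y fun h ↦ hy' (Icc_subset_Icc (by linarith) hcc h)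
        simp only [Pi.sub_apply, Finset.sum_apply, Pi.smul_apply, hFdef, indicator_of_notMem hy', hvy, smul_zero,
          Finset.sum_const_zero, mul_zero, sub_zero]
    intro α
    have h := dt_hPSD_of_dominated
      (fun i j ↦ (weilPoleForm₂ (v i) (v j) + weilDirichletEnergy₂ c' (v i) (v j) -
          weilMarkovConstant c' * ∫ x, (v i x * conj (v j x)).re) - lam * ∫ x, (v i x * conj (v j x)).re)
      hwm hwC hw0 (fun i ↦ F i - ∑ l, W i l • v l) (fun i ↦ Fx i - ∑ l, W i l • v l) hr hrx hdom
      (fun α ↦ by simpa only [hwdef, hnE, hnM, hnI] using hPSD α) α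
    simpa only [hE₂, hM] using h
  -- apply the cut Ritz theorem with the three-zone level
  refine dt_sector_bound_of_cut_w hc' hcc σ g hpc hgp v F hv
    (fun i y ↦ by rw [hFdef]) W (fun i ↦ 2 * ((R.get i).1 : ℝ)) lam
    (fun i ↦ mul_nonneg zero_le_two (by exact_mod_cast hRμ i))
    (n := nf) (w := w) (C := C) hnfm hwm hnC hwC hn0 hw0 hwn ?_ hPSD' hφ hφs hφp
  -- the leaky three-zone certificate on smooth parity-σ tests of the window `c`
  intro ψ hψ hψs hψp
  have hψa : tsupport ψ ⊆ Icc (-a₀) a₀ := hψs.trans (Icc_subset_Icc (by linarith) hca)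
  have h23 := hcert23 ψ hψ hψa hψp
  have hleak := dt_cert_leak_approx R n hcc hca hRμ hψ hψs h23 g (fun i ↦ (hg i).continuous) v hv hν
  have hsl := dt_weilTwoPrimeQuadratic_sub_edges45_le_weilQuadratic_re hψ hψs hc7 hy₄ hy₅
  have h2 : Integrable fun u : ℝ ↦ ‖ψ u‖ ^ 2 := hψ.integrable_norm_sq
  have hn_int : (∫ y, nf y * ‖ψ y‖ ^ 2) =
      nI * (∫ y, ‖ψ y‖ ^ 2) + (nM - nI) * (∫ y, E₄.indicator (fun u ↦ ‖ψ u‖ ^ 2) y) +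
        (nE - nM) * ∫ y, E₅.indicator (fun u ↦ ‖ψ u‖ ^ 2) y := by
    rw [hnfdef]
    exact dt_integral_piecewise3_mul hE₄ hE₅ h54 nE nM nI h2
  have hMI : nM - nI = -κ₄ := by rw [hnM, hnI]; ring
  have hEM : nE - nM = -κ₅ := by rw [hnE, hnM]; ring
  rw [hn_int, hMI, hEM, hnI]
  have hX4 : 0 ≤ ∫ y, E₄.indicator (fun u ↦ ‖ψ u‖ ^ 2) y :=
    integral_nonneg fun y ↦ Set.indicator_nonneg (fun _ _ ↦ by positivity) y
  have hX5 : 0 ≤ ∫ y, E₅.indicator (fun u ↦ ‖ψ u‖ ^ 2) y :=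
    integral_nonneg fun y ↦ Set.indicator_nonneg (fun _ _ ↦ by positivity) y
  have hκX4 := mul_le_mul_of_nonneg_right hκ₄ hX4
  have hκX5 := mul_le_mul_of_nonneg_right hκ₅ hX5
  have hws : weilNorm2Sq ψ = ∫ x, ‖ψ x‖ ^ 2 := rfl
  rw [hws] at h23
  nlinarith [hleak, hsl, hκX4, hκX5, hX4, hX5]

/-- **`λ ≤ ε_od(c)` beyond `(log 5)/2`, approximate odd trial vectors**: the odd-sector form of
`dt_sector_bound_of_deflCert_wxa45`. [folklore] -/
theorem dt_weilOddGroundEnergy_ge_of_deflCert_wxa45 {c c' b a₀ : ℝ} (hc'2 : Real.log 2 < c') (hcc : c' ≤ c)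
    (hc7 : c ≤ Real.log 7 / 2) (hcb : c ≤ b) (hca : c ≤ a₀)
    (hPI : weilPrimeIndex c = weilPrimeIndex c') (hM : weilMarkovConstant c = weilMarkovConstant c')
    (hE₂ : ∀ f h, weilDirichletEnergy₂ c f h = weilDirichletEnergy₂ c' f h)
    (R : List (ℚ × ℕ × List ℚ)) (n : ℕ) {β₂₃ : ℝ}
    (g : Fin R.length → ℝ → ℝ) (hg : ∀ i, ContDiff ℝ 2 (g i)) (hgo : ∀ i x, g i (-x) = -g i x)
    (hRμ : ∀ i : Fin R.length, 0 ≤ (R.get i).1)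
    (hcert23 : ∀ g : ℝ → ℂ, IsWeilTest g → tsupport g ⊆ Icc (-a₀) a₀ → (∀ x, g (-x) = -g x) →
      β₂₃ * weilNorm2Sq g ≤ weilTwoPrimeQuadratic g +
        (R.map fun r ↦ (r.1 : ℝ) * ‖∑ k ∈ Finset.range n, ((maskV r k : ℚ) : ℂ) * weilMoment a₀ g k‖ ^ 2).sum)
    (v Fx : Fin R.length → ℝ → ℂ)
    (hv : ∀ i x, v i x = (((Icc (-c') c').indicator (g i) x : ℝ) : ℂ))
    (hFx : ∀ i y, Fx i y = (Icc (-b) b).indicator (fun y ↦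
        2 * (∫ x, v i x * (Real.cosh (x / 2) : ℂ)) * (Real.cosh (y / 2) : ℂ) -
          2 * (∫ x, v i x * (Real.sinh (x / 2) : ℂ)) * (Real.sinh (y / 2) : ℂ) +
        (∑ m ∈ weilPrimeIndex c', (((ArithmeticFunction.vonMangoldt m : ℝ) / Real.sqrt m : ℝ) : ℂ) *
          (2 * v i y - v i (y - Real.log m) - v i (y + Real.log m))) +
        ∫ t in Ioi 0, (weilArchDensity t : ℂ) * (2 * v i y - v i (y - t) - v i (y + t))) y -
      (weilMarkovConstant c' : ℂ) * v i y)
    (W : Fin R.length → Fin R.length → ℝ) {κ₄ κ₅ : ℝ} (hκ₄ : Real.log 2 / 2 ≤ κ₄)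
    (hκ₅ : Real.log 5 / Real.sqrt 5 ≤ κ₅)
    {ν : ℝ} (hν : ∑ i : Fin R.length, ((R.get i).1 : ℝ) *
      ((∫ x in Icc (-c') c', (maskPoly (R.get i) n a₀ x - g i x) ^ 2) +
        ∫ x in Icc (-a₀) a₀ \ Icc (-c') c', (maskPoly (R.get i) n a₀ x) ^ 2) ≤ ν)
    {lam : ℝ} (hlam : lam < β₂₃ - 2 * ν - κ₄ - κ₅) {y₄ y₅ : ℝ} (hy₄ : y₄ ≤ Real.log 4 - c)
    (hy₅ : y₅ ≤ Real.log 5 - c) (hy45 : y₄ ≤ y₅)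
    (hPSD : ∀ α : Fin R.length → ℝ, 0 ≤ ∑ i, ∑ j, α i * α j *
      ((weilPoleForm₂ (v i) (v j) + weilDirichletEnergy₂ c' (v i) (v j) -
          weilMarkovConstant c' * ∫ x, (v i x * conj (v j x)).re) - lam * (∫ x, (v i x * conj (v j x)).re) -
        ∫ y, {u : ℝ | y₅ ≤ |u|}.piecewise (fun _ ↦ 1 / (β₂₃ - 2 * ν - κ₄ - κ₅ - lam))
            ({u : ℝ | y₄ ≤ |u|}.piecewise (fun _ ↦ 1 / (β₂₃ - 2 * ν - κ₄ - lam))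
              (fun _ ↦ 1 / (β₂₃ - 2 * ν - lam))) y *
          ((Fx i - ∑ l, W i l • v l) y * conj ((Fx j - ∑ l, W j l • v l) y)).re)) :
    lam ≤ weilOddGroundEnergy c := by
  have hc : 0 < c := lt_of_lt_of_le ((Real.log_pos (by norm_num)).trans hc'2) hcc
  refine le_weilOddGroundEnergy_of_forall hc fun φ hφ hφs hφo hφn ↦ ?_
  have h := dt_sector_bound_of_deflCert_wxa45 hc'2 hcc hc7 hcb hca hPI hM hE₂ (-1) R n g hg
    (fun i x ↦ by rw [hgo i x]; ring) hRμ
    (fun g hg hgs hgp ↦ hcert23 g hg hgs (fun x ↦ by simpa using hgp x)) v Fx hv hFx W hκ₄ hκ₅ hν hlam hy₄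
    hy₅ hy45 hPSD hφ hφs (fun x ↦ by simpa using hφo x)
  rwa [hφn, mul_one] at h

/-- **`λ ≤ ε_ev(c)` beyond `(log 5)/2`, approximate even trial vectors**: the even-sector form of
`dt_sector_bound_of_deflCert_wxa45`.  With `λ = 0` this is the positivity-grade even block of the window `c`.
[folklore] -/
theorem dt_weilEvenGroundEnergy_ge_of_deflCert_wxa45 {c c' b a₀ : ℝ} (hc'2 : Real.log 2 < c') (hcc : c' ≤ c)
    (hc7 : c ≤ Real.log 7 / 2) (hcb : c ≤ b) (hca : c ≤ a₀)
    (hPI : weilPrimeIndex c = weilPrimeIndex c') (hM : weilMarkovConstant c = weilMarkovConstant c')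
    (hE₂ : ∀ f h, weilDirichletEnergy₂ c f h = weilDirichletEnergy₂ c' f h)
    (R : List (ℚ × ℕ × List ℚ)) (n : ℕ) {β₂₃ : ℝ}
    (g : Fin R.length → ℝ → ℝ) (hg : ∀ i, ContDiff ℝ 2 (g i)) (hge : ∀ i x, g i (-x) = g i x)
    (hRμ : ∀ i : Fin R.length, 0 ≤ (R.get i).1)
    (hcert23 : ∀ g : ℝ → ℂ, IsWeilTest g → tsupport g ⊆ Icc (-a₀) a₀ → (∀ x, g (-x) = g x) →
      β₂₃ * weilNorm2Sq g ≤ weilTwoPrimeQuadratic g +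
        (R.map fun r ↦ (r.1 : ℝ) * ‖∑ k ∈ Finset.range n, ((maskV r k : ℚ) : ℂ) * weilMoment a₀ g k‖ ^ 2).sum)
    (v Fx : Fin R.length → ℝ → ℂ)
    (hv : ∀ i x, v i x = (((Icc (-c') c').indicator (g i) x : ℝ) : ℂ))
    (hFx : ∀ i y, Fx i y = (Icc (-b) b).indicator (fun y ↦
        2 * (∫ x, v i x * (Real.cosh (x / 2) : ℂ)) * (Real.cosh (y / 2) : ℂ) -
          2 * (∫ x, v i x * (Real.sinh (x / 2) : ℂ)) * (Real.sinh (y / 2) : ℂ) +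
        (∑ m ∈ weilPrimeIndex c', (((ArithmeticFunction.vonMangoldt m : ℝ) / Real.sqrt m : ℝ) : ℂ) *
          (2 * v i y - v i (y - Real.log m) - v i (y + Real.log m))) +
        ∫ t in Ioi 0, (weilArchDensity t : ℂ) * (2 * v i y - v i (y - t) - v i (y + t))) y -
      (weilMarkovConstant c' : ℂ) * v i y)
    (W : Fin R.length → Fin R.length → ℝ) {κ₄ κ₅ : ℝ} (hκ₄ : Real.log 2 / 2 ≤ κ₄)
    (hκ₅ : Real.log 5 / Real.sqrt 5 ≤ κ₅)
    {ν : ℝ} (hν : ∑ i : Fin R.length, ((R.get i).1 : ℝ) *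
      ((∫ x in Icc (-c') c', (maskPoly (R.get i) n a₀ x - g i x) ^ 2) +
        ∫ x in Icc (-a₀) a₀ \ Icc (-c') c', (maskPoly (R.get i) n a₀ x) ^ 2) ≤ ν)
    {lam : ℝ} (hlam : lam < β₂₃ - 2 * ν - κ₄ - κ₅) {y₄ y₅ : ℝ} (hy₄ : y₄ ≤ Real.log 4 - c)
    (hy₅ : y₅ ≤ Real.log 5 - c) (hy45 : y₄ ≤ y₅)
    (hPSD : ∀ α : Fin R.length → ℝ, 0 ≤ ∑ i, ∑ j, α i * α j *
      ((weilPoleForm₂ (v i) (v j) + weilDirichletEnergy₂ c' (v i) (v j) -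
          weilMarkovConstant c' * ∫ x, (v i x * conj (v j x)).re) - lam * (∫ x, (v i x * conj (v j x)).re) -
        ∫ y, {u : ℝ | y₅ ≤ |u|}.piecewise (fun _ ↦ 1 / (β₂₃ - 2 * ν - κ₄ - κ₅ - lam))
            ({u : ℝ | y₄ ≤ |u|}.piecewise (fun _ ↦ 1 / (β₂₃ - 2 * ν - κ₄ - lam))
              (fun _ ↦ 1 / (β₂₃ - 2 * ν - lam))) y *
          ((Fx i - ∑ l, W i l • v l) y * conj ((Fx j - ∑ l, W j l • v l) y)).re)) :
    lam ≤ weilEvenGroundEnergy c := by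
  have hc : 0 < c := lt_of_lt_of_le ((Real.log_pos (by norm_num)).trans hc'2) hcc
  refine le_weilEvenGroundEnergy_of_forall hc fun φ hφ hφs hφe hφn ↦ ?_
  have h := dt_sector_bound_of_deflCert_wxa45 hc'2 hcc hc7 hcb hca hPI hM hE₂ 1 R n g hg
    (fun i x ↦ by rw [hge i x]; ring) hRμ
    (fun g hg hgs hgp ↦ hcert23 g hg hgs (fun x ↦ by simpa using hgp x)) v Fx hv hFx W hκ₄ hκ₅ hν hlam hy₄
    hy₅ hy45 hPSD hφ hφs (fun x ↦ by simpa using hφe x)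
  rwa [hφn, mul_one] at h

end Summit.RiemannHypothesis.RiemannHypothesis.Theorems.EvenWinsBeyondArch

end
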